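import Summits.Ventures.PercRepro.C026LemmaD

/-!
# Theorem C(c): the free targets of C-026 (dossier §11 S1) (p5, gen 7)

mine-3's Theorem C: `τ₅₀ = kSwapSealed c b` restricts to a bijection `{S ∈ bot : O1 S} → ac|b ∖ D_ac`,
`D_ac := {T ∈ ac|b : a ∈ Com_c(T̄ ∖ E[Com_b T])}` (typer-1's `sealedCompl b T` is `T̄` with the edges at
`Com_b(T)` closed), and the free `ac|b` targets are exactly `τ₅₀(Kc) ⊔ D_ac`:

* **`isBot_kSwapSealedInv_iff`** (Theorem C(b)): for `T ∈ ac|b`, `τ₅₀⁻¹(T) ∈ bot ⟺ a ∉ N_T`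
  (`N_T = Com_c(sealedCompl b T)`; from typer-1's `cluster_sealedCompl_kSwapSealed`);
* **`freeAC_iff`** (Theorem C(c)): `FreeAC T ⟺ D_ac T ∨ ∃ ω ∈ Kc, τ₅₀ ω = T`, and the two are disjoint
  (`not_dAC_of_kc`);
* the mirror for `bc|a` (`freeBC_iff`): `FreeBC T ⟺ D_bc T ∨ ∃ ω ∈ Lc ⊔ KLc₂, τ₁₈ ω = T` (`bot` with the
  second offer, and not bad or with the first offer).
-/

namespace PercRepro

namespace MultiGraph

section TheoremC

variable {V E : Type*} (G : MultiGraph V E)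

/-- **`D_ac`**: the `ac|b` configurations whose `τ₅₀`-preimage is not in `bot` —
`a ∈ Com_c(T̄ ∖ E[Com_b T])`. -/
def DAC (T : Config E) (a b c : V) : Prop :=
  G.CellAC T a b c ∧ a ∈ G.cluster (G.sealedCompl b T) c

/-- **`D_bc`**: the `bc|a` configurations whose `τ₁₈`-preimage is not in `bot`. -/
def DBC (T : Config E) (a b c : V) : Prop :=
  G.CellBC T a b c ∧ b ∈ G.cluster (G.sealedCompl a T) c

variable [Fintype E]

/-- `τ₅₀ = kSwapSealed c b` is a bijection of the finite cube (typer-1's injectivity). -/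
theorem kSwapSealed_bijective (x y : V) : Function.Bijective (G.kSwapSealed x y) :=
  Finite.injective_iff_bijective.mp (G.kSwapSealed_injective x y)

/-- The decoder is a right inverse: `τ₅₀ (τ₅₀⁻¹ T) = T`. -/
theorem kSwapSealed_kSwapSealedInv (x y : V) (T : Config E) :
    G.kSwapSealed x y (G.kSwapSealedInv x y T) = T := by
  obtain ⟨ω, rfl⟩ := (G.kSwapSealed_bijective x y).2 T
  rw [G.kSwapSealedInv_kSwapSealed]

/-- For `S′ = τ₅₀⁻¹ T`: `Com_b(S′) = Com_b(T)` (the sealed cluster). -/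
theorem cluster_b_kSwapSealedInv (T : Config E) (b c : V) :
    G.cluster (G.kSwapSealedInv c b T) b = G.cluster T b := by
  have h := G.cluster_kSwapSealed_c c b (G.kSwapSealedInv c b T)
  rw [G.kSwapSealed_kSwapSealedInv] at h
  exact h.symm

/-- For `T ∈ ac|b` and `S′ = τ₅₀⁻¹ T`: `b ≁_{S′} c`. -/
theorem not_conn_b_c_kSwapSealedInv {T : Config E} {a b c : V} (hT : G.CellAC T a b c) :
    ¬ G.Conn (G.kSwapSealedInv c b T) b c := by
  intro hbc
  have : c ∈ G.cluster (G.kSwapSealedInv c b T) b := hbc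
  rw [G.cluster_b_kSwapSealedInv T b c] at this
  exact hT.2 (hT.1.trans (this : G.Conn T b c).symm)

/-- For `T ∈ ac|b` and `S′ = τ₅₀⁻¹ T`: `N_T = Com_c(S′)` (typer-1's `cluster_sealedCompl_kSwapSealed`). -/
theorem cluster_c_kSwapSealedInv {T : Config E} {a b c : V} (hT : G.CellAC T a b c) :
    G.cluster (G.sealedCompl b T) c = G.cluster (G.kSwapSealedInv c b T) c := by
  have hbc : b ∉ G.cluster (G.kSwapSealedInv c b T) c :=
    fun h => G.not_conn_b_c_kSwapSealedInv hT (h : G.Conn _ c b).symm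
  have h := G.cluster_sealedCompl_kSwapSealed hbc
  rw [G.kSwapSealed_kSwapSealedInv] at h
  exact h

/-- **Theorem C(b)**: for `T ∈ ac|b`, `τ₅₀⁻¹(T) ∈ bot ⟺ a ∉ N_T`. -/
theorem isBot_kSwapSealedInv_iff {T : Config E} {a b c : V} (hT : G.CellAC T a b c) :
    G.IsBot (G.kSwapSealedInv c b T) a b c ↔ a ∉ G.cluster (G.sealedCompl b T) c := by
  rw [G.cluster_c_kSwapSealedInv hT]
  constructor
  · intro h ha
    exact h.2.1 (ha : G.Conn _ c a).symm
  · intro ha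
    refine ⟨fun hab => ?_, fun hac => ha hac.symm, G.not_conn_b_c_kSwapSealedInv hT⟩
    have : a ∈ G.cluster (G.kSwapSealedInv c b T) b := hab.symm
    rw [G.cluster_b_kSwapSealedInv T b c] at this
    exact hT.2 (this : G.Conn T b a).symm

/-- A `τ₅₀`-preimage in `bot` of an `ac|b` configuration has the first offer. -/
theorem o1_kSwapSealedInv {T : Config E} {a b c : V} (hT : G.CellAC T a b c)
    (hbot : G.IsBot (G.kSwapSealedInv c b T) a b c) : G.O1 (G.kSwapSealedInv c b T) a b c :=
  ⟨hbot, by rw [G.kSwapSealed_kSwapSealedInv]; exact hT⟩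

/-- **Theorem C(c)**: the free `ac|b` targets are `D_ac` together with the `τ₅₀`-images of `Kc`. -/
theorem freeAC_iff (T : Config E) (a b c : V) :
    G.FreeAC T a b c ↔ G.DAC T a b c ∨ ∃ ω, G.Kc ω a b c ∧ G.kSwapSealed c b ω = T := by
  constructor
  · rintro ⟨hT, hfree⟩
    by_cases hbot : G.IsBot (G.kSwapSealedInv c b T) a b c
    · have hnbad : ¬ G.BadM (G.kSwapSealedInv c b T) a b c := fun hbad =>
        hfree _ ⟨hbot, hbad.2⟩ (G.o1_kSwapSealedInv hT hbot) (G.kSwapSealed_kSwapSealedInv c b T)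
      exact Or.inr ⟨G.kSwapSealedInv c b T, ⟨hbot, hnbad, G.o1_kSwapSealedInv hT hbot⟩,
        G.kSwapSealed_kSwapSealedInv c b T⟩
    · refine Or.inl ⟨hT, ?_⟩
      by_contra ha
      exact hbot ((G.isBot_kSwapSealedInv_iff hT).mpr ha)
  · rintro (⟨hT, ha⟩ | ⟨ω, ⟨hbot, hnbad, ho1⟩, rfl⟩)
    · refine ⟨hT, fun ω hω _ heq => ?_⟩
      have hω' : ω = G.kSwapSealedInv c b T := by
        rw [← heq, G.kSwapSealedInv_kSwapSealed]
      rw [hω'] at hω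
      exact (G.isBot_kSwapSealedInv_iff hT).mp hω.1 ha
    · refine ⟨ho1.2, fun ω' hω' _ heq => ?_⟩
      have : ω' = ω := G.kSwapSealed_injective c b heq
      subst this
      exact hnbad ⟨⟨hω'.1.2.1, hω'.1.2.2⟩, hω'.2⟩

/-- The two parts of `FreeAC` are disjoint: a `τ₅₀`-image of `Kc` is not in `D_ac`. -/
theorem not_dAC_of_kc {ω : Config E} {a b c : V} (h : G.Kc ω a b c) :
    ¬ G.DAC (G.kSwapSealed c b ω) a b c := by
  rintro ⟨hT, ha⟩
  have hbot : G.IsBot (G.kSwapSealedInv c b (G.kSwapSealed c b ω)) a b c := by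
    rw [G.kSwapSealedInv_kSwapSealed]
    exact h.1
  exact (G.isBot_kSwapSealedInv_iff hT).mp hbot ha

/-! ### The mirror for `bc|a` -/

/-- For `S″ = τ₁₈⁻¹ T`: `Com_a(S″) = Com_a(T)` (the sealed cluster). -/
theorem cluster_a_kSwapSealedInv (T : Config E) (a c : V) :
    G.cluster (G.kSwapSealedInv c a T) a = G.cluster T a := by
  have h := G.cluster_kSwapSealed_c c a (G.kSwapSealedInv c a T)
  rw [G.kSwapSealed_kSwapSealedInv] at h
  exact h.symm

/-- For `T ∈ bc|a` and `S″ = τ₁₈⁻¹ T`: `a ≁_{S″} c`. -/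
theorem not_conn_a_c_kSwapSealedInv {T : Config E} {a b c : V} (hT : G.CellBC T a b c) :
    ¬ G.Conn (G.kSwapSealedInv c a T) a c := by
  intro hac
  have : c ∈ G.cluster (G.kSwapSealedInv c a T) a := hac
  rw [G.cluster_a_kSwapSealedInv T a c] at this
  exact hT.2 ((this : G.Conn T a c).trans hT.1.symm)

/-- For `T ∈ bc|a` and `S″ = τ₁₈⁻¹ T`: `N_T = Com_c(S″)`. -/
theorem cluster_c_kSwapSealedInv' {T : Config E} {a b c : V} (hT : G.CellBC T a b c) :
    G.cluster (G.sealedCompl a T) c = G.cluster (G.kSwapSealedInv c a T) c := by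
  have hac : a ∉ G.cluster (G.kSwapSealedInv c a T) c :=
    fun h => G.not_conn_a_c_kSwapSealedInv hT (h : G.Conn _ c a).symm
  have h := G.cluster_sealedCompl_kSwapSealed hac
  rw [G.kSwapSealed_kSwapSealedInv] at h
  exact h

/-- **Theorem C(b), mirror**: for `T ∈ bc|a`, `τ₁₈⁻¹(T) ∈ bot ⟺ b ∉ N_T`. -/
theorem isBot_kSwapSealedInv_iff' {T : Config E} {a b c : V} (hT : G.CellBC T a b c) :
    G.IsBot (G.kSwapSealedInv c a T) a b c ↔ b ∉ G.cluster (G.sealedCompl a T) c := by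
  rw [G.cluster_c_kSwapSealedInv' hT]
  constructor
  · intro h hb
    exact h.2.2 (hb : G.Conn _ c b).symm
  · intro hb
    refine ⟨fun hab => ?_, G.not_conn_a_c_kSwapSealedInv hT, fun hbc => hb hbc.symm⟩
    have : b ∈ G.cluster (G.kSwapSealedInv c a T) a := hab
    rw [G.cluster_a_kSwapSealedInv T a c] at this
    exact hT.2 this

/-- A `τ₁₈`-preimage in `bot` of a `bc|a` configuration has the second offer. -/
theorem o2_kSwapSealedInv {T : Config E} {a b c : V} (hT : G.CellBC T a b c)
    (hbot : G.IsBot (G.kSwapSealedInv c a T) a b c) : G.O2 (G.kSwapSealedInv c a T) a b c :=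
  ⟨hbot, by rw [G.kSwapSealed_kSwapSealedInv]; exact hT⟩

/-- **Theorem C(c), mirror**: the free `bc|a` targets are `D_bc` together with the `τ₁₈`-images of
`Lc ⊔ KLc₂` (`bot` with the second offer, and not bad or with the first offer). -/
theorem freeBC_iff (T : Config E) (a b c : V) :
    G.FreeBC T a b c ↔ G.DBC T a b c ∨
      ∃ ω, (G.IsBot ω a b c ∧ G.O2 ω a b c ∧ (¬ G.BadM ω a b c ∨ G.O1 ω a b c)) ∧
        G.kSwapSealed c a ω = T := by
  constructor
  · rintro ⟨hT, hfree⟩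
    by_cases hbot : G.IsBot (G.kSwapSealedInv c a T) a b c
    · refine Or.inr ⟨G.kSwapSealedInv c a T, ⟨hbot, G.o2_kSwapSealedInv hT hbot, ?_⟩,
        G.kSwapSealed_kSwapSealedInv c a T⟩
      by_contra hcon
      push Not at hcon
      exact hfree _ ⟨hbot, hcon.1.2⟩ (G.o2_kSwapSealedInv hT hbot) hcon.2
        (G.kSwapSealed_kSwapSealedInv c a T)
    · refine Or.inl ⟨hT, ?_⟩
      by_contra hb
      exact hbot ((G.isBot_kSwapSealedInv_iff' hT).mpr hb)
  · rintro (⟨hT, hb⟩ | ⟨ω, ⟨_, ho2, hor⟩, rfl⟩)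
    · refine ⟨hT, fun ω hω _ _ heq => ?_⟩
      have hω' : ω = G.kSwapSealedInv c a T := by
        rw [← heq, G.kSwapSealedInv_kSwapSealed]
      rw [hω'] at hω
      exact (G.isBot_kSwapSealedInv_iff' hT).mp hω.1 hb
    · refine ⟨ho2.2, fun ω' hω' _ hno1 heq => ?_⟩
      have : ω' = ω := G.kSwapSealed_injective c a heq
      subst this
      rcases hor with hnbad | ho1
      · exact hnbad ⟨⟨hω'.1.2.1, hω'.1.2.2⟩, hω'.2⟩
      · exact hno1 ho1

end TheoremC

end MultiGraph

end PercRepro
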